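import Summits.QuantumFields.BalabanUV.Beta.FP.NestedStepLawTorusTransportedGradedSymULow
import Summits.QuantumFields.BalabanUV.Beta.FP.NestedStepLawTorusTransportedRowsGradedSym
import Summits.QuantumFields.BalabanUV.Beta.FP.NestedStepLawTorusInstanceRows
import Summits.QuantumFields.BalabanUV.Beta.FP.PeriodisedSymBorderWardContactInstance
import Summits.QuantumFields.BalabanUV.Beta.FP.PeriodisedSymCoarseWardContact
import Summits.QuantumFields.BalabanUV.Beta.FP.PeriodisedSymCompositeIndexWard
import Summits.QuantumFields.BalabanUV.Beta.FP.TorusGeneratorIntertwining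

/-!
# `BalabanUV.Beta.FP.NestedStepLawTorusTransportedRowsGradedSymULow` — road «FP» for binder row D1, ROUTE T, presentation T-β, option (δ) «LIFT ∕ GRADED» (R-FP-54′),
# an2's (J-a) programme item (β-b) ON THE uLow BOTTOM: **THE (III′) TORUS CALL (`NestedStepLawTorusTransportedGradedSymULow`, (β-a′)) WITH leaf-02's ONE-SIDED
# ROWS `a0 c1 d1 t1 q1`, THE INTERTWINING LETTER `j1` AND THE PARITY `hH₀t` DISCHARGED BY TERM** — identical to `NestedStepLawTorusTransportedRowsGradedSym`
# ((β-b), p333281) except that the small-comb dead rows `s1 s2` are replaced by the fine block's Faddeev–Popov letter `uLow` (leaf-06 g21 OFFER O-d1leaf06g21-1: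
# `NestedFPSplit`), which the next layer discharges with NO hypothesis on the direction `h`.  §0 of (β-b) (`perF_bhKStepSh_Dsh_ff_eq_perF_bhKStepAt`,
# `torus_t1_sym_of_average_dead`) is REUSED BY NAME.  The rest of this docstring is (β-b)'s.

WHAT.  `NestedStepLawTorusTransportedGradedSym.secondVar_oneShot_nestedStepLaw_torus_transported_graded_sym` ((β-a), leaf-02 g21) is the OWNER d1-p3 g19's graded
torus call `NestedStepLawTorusTransportedGraded` (#12) re-instantiated at the (III′)∕sym tables of an2's (J-a) TABLE (`HOME/b2b-balaban-beta-an2/gen39/JA-TABLE.v1.md`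
v1.2): averaging blocks `Q₁₀ ∕ Q₂₀ := perF (𝕄_j ∕ 𝕄_{j+1})∘((coarse, inr), fields)`, `𝕄_j = bhKStepSh d Lc (Dsh Lc) j` (an1's shifted straight spread), every comb
(`τ₁ τ₂ P D₁ D₂ D̄`) at the CENTRED root `ρ_c = ctr (d+1) Lc = toSite (ctrOff (d+1) Lc)`, the form block `H₀` FREE, and — displayed beyond #12's letters — the
(γ-sym) sockets `h1 h2` and the parity `hH₀t`.  Under R-FP-54′ the graded door consumes leaf-02's one-sided rows UN-LIFTED, and this lineage has typed their
SYM producers (the rooted producers' twins under `vhSAt (toSite r) ↦ symVhSAt ρ_c`, `bhKStepAt d (toSite r) Lc j ↦ 𝕄_j`):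

* `hH₀` BOUND: `H₀ := perF F 𝕄_j ∘ (fields, fields)` (`F = fine Lc M′`).  On the (fields, fields) block `𝕄_j` IS the rooted candidate `bhKStepAt d ρ_c Lc j`
  entrywise (§0 `bhKStepSh_Dsh_inl_inl_eq_bhKStepAt`: level 0 — the window-free `d*d` of `bhK`, `Dsh` vanishes on (fields, fields) (an1 `DshAn1.Dsh_inl_inl`);
  level `j+1` — both are `wVH·E2`), so `H₀ = perF F (bhKStepAt d (toSite (ctrOff (d+1) Lc)) Lc j) ∘ (fields, fields)` and the ROOTED order-0 producers apply
  at `r := ctrOff (d+1) Lc` (`AveragingContoursRooted.ctrOff_mem_box`): `hH₀t` — `PeriodisedWardOrderZero.torus_H₀_transpose`; `a0` — `torus_a0_letter` at `Y₀ := 0`;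
* `c1` — `PeriodisedSymBorderWardContactInstance.torus_c1_symVhSAt_weighted` ((α-1b)), the fine sym insertion-table family `hQ₁₁` along `h`;
* `d1` — `PeriodisedSymCoarseWardContact.torus_d1_symVhSAt_weighted`, the coarse sym family `hQ₂₁` transported by `θ_j·Q₁₀`;
* `t1` — `c1` ∘ `NestedStepLawTorusInstanceRows.torus_combSlice_mul_Db1_eq_zero` (generic in the root and in `Q₁₀`), hypothesis `hdead` displayed (the
  nested chart's direction is average-coarse-comb-dead, as in the rooted `torus_t1_of_average_dead`);
* `q1` — `PeriodisedSymCompositeIndexWard.torus_q1_sym_letter`: the conjugated first composite averaging word IS the composite sym insertion jet along the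
  GAUGE-SHIFTED direction `h + Dλ` (`h𝔔'₁` NAMED; `X X̄` PINNED to the diagonal gauge generators of `λ`, `hX hXbar` — the composite multiplier rotates at the
  CENTRED root of its block, `X̄ = c • diagonal (Σ_t tdelta M′ (p α + ρ_c) t · Σ_s tdelta F (Lc•t + ρ_c) s · λ s)`);
* `j1` — leaf-06's `TorusGeneratorIntertwining.torus_j1` (p320573) after `weightedJet_eq` (chart-free, root-generic), `hW'₁ hC₁` VERBATIM at the centred roots.

This file is ONE theorem **`secondVar_oneShot_nestedStepLaw_torus_transported_graded_rows_sym`** = the (β-a) call with those seven binders REMOVED and the row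
data bound by defining equations (`hH₀ hQ₁₁ hQ₂₁ hW₁ hDb₁ hdead hX hXbar h𝔔'₁ hW'₁ hC₁` — the rooted file's spellings under the substitution, nothing else
changed), plus §0's entry identity.  Proof = `subst` + ONE TERM.  [folklore] composition BY NAME; no `def`, no `def … : Prop`, nothing cited, 0 sorry.
Nothing of the dictionary asserted: whether the (III′) literal's tables satisfy the displayed graded letters is an2's (J-a) TABLE ∕ the OWNER's word; the
(γ-sym) sockets `h1 h2` are leaf-05 g29's (`RelInvPeriodisedChart` lineage: `torus_isUnit_det_kkt_combRows_comb`, `torus_h2_record_comb`), displayed here.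

What STAYS displayed: `h1 h2`, `k1 k2` (GRADED form words; `H₁ :=` the FULL first-order (fields, fields) jet — Wilson + Λ-sector — is the level-0 instance's
binding, an2 W-an2-g40-6: the Λ half is exponentially localised and may ride as a separate additive family, rows being linear in `H₁`), `q2 j2` (order 2), `uC`,
`uP'`, the nested dead rows `s1 s2 t2`, the parities `hH₁t hH₂t`, the graded Ward rows `a1 a2` (read at `Y₀ = 0`), the covariance rows `c2 d2`, block namings.

HONEST DEPENDENCY (page 1, mandatory): continuum YM on T⁴ ⇐ BetaPertH ∧ nine spine estimates (0/9 proved); BetaPertH ⇐ (D1) ∧ (D4) ∧ CAP+tail;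
G-an2-4 gates asym, D1 and NE2/3/4.  HONEST FRAMING (cell contract, verbatim): «discharging `BetaPertH` makes Bałaban's UV stability UNCONDITIONAL —
a real constructive-QFT result; it is NOT the continuum limit and NOT the Clay problem.»  ABSOLUTE RULE (cell charter, verbatim): «No internally-minted
statement may enter as a cited fact. Every hypothesis is either kernel-proved in this package or a verbatim quotation of a PUBLISHED theorem with page
reference. The manuscript(s) under audit are NOT citable for their own disputed steps — they are the thing under adjudication; programme-internal
(2001/route/tribunal) claims are never citable.»  0 estimates; 0∕4 row-D1 binders; NOT (T-ID)∕(T-β) complete, NOT (J-a) complete, NOT SDF, NOT D1, NOT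
BetaPertH, NOT continuum, NOT Clay.  Road «FP», D1 formalisation swarm leaf-02 (b2b-balaban-beta-d1-formalise-leaf-02) gen 21, 2026-08-22 (an2 W-an2-g39-10 ∕
JA-TABLE v1.2 (β); OWNER d1-p3 g19 W-FP-19-4 «the graded ROWS are yours»).  No existing file touched.
-/

noncomputable section

open scoped BigOperators Matrix

namespace Summit.QuantumFields.BalabanUV.Beta.FP.NestedStepLawTorusTransportedRowsGradedSymULow

open Matrix Finset
open Literature.Probability.LatticeModels (Torus.proj)
open Literature.MathematicalPhysics.QuantumFieldTheory.Balaban1983to89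
open Literature.MathematicalPhysics.QuantumFieldTheory.Balaban1983to89.Beta
open Literature.MathematicalPhysics.QuantumFieldTheory.Balaban1983to89.Beta.Composition (kkt)
open Literature.MathematicalPhysics.QuantumFieldTheory.Balaban1983to89.Beta.CompositionSingular (effForm flucCov minOp minOpL)
open Literature.MathematicalPhysics.QuantumFieldTheory.LatticeForm (quo)
open B5Prop11Plancherel (fine)
open B6Lemma24Torus (pbox mem_pbox)
open AffineAveraging (Site box toSite unitVec)
open AveragingContoursRooted (ctr ctrOff ctrOff_mem_box)
open SymAveragingHessianCounts (symVhSAt)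
open OneStepResolventKernel (Fib)
open Summit.QuantumFields.BalabanUV.Beta.BorderedHessian (bhKStepAt stepScale bhKStepAt_zero bhKStepAt_succ_inl_inl bhKAt_inl_inl bhKStep_succ_inl_inl)
open Summit.QuantumFields.BalabanUV.Beta.DshAn1 (Dsh Dsh_inl_inl)
open Summit.QuantumFields.BalabanUV.Beta.SymShiftedSpread (bhKStepSh bhKStepSh_zero bhKStepSh_apply)
open Summit.QuantumFields.BalabanUV.Beta.D1BFx.LogDetSecondVariation (secondVar)
open Summit.QuantumFields.BalabanUV.Beta.FP.KernelPeriodisationFib (Idx perF perF_apply perZ_apply)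
open Summit.QuantumFields.BalabanUV.Beta.FP.KernelPeriodisationFibLoc (dper)
open Summit.QuantumFields.BalabanUV.Beta.FP.TorusGaugeCovariance (tdelta tgrad)
open Summit.QuantumFields.BalabanUV.Beta.FP.TorusGaugeCovarianceCoarse (coarsePt tgradBlock)
open Summit.QuantumFields.BalabanUV.Beta.FP.TorusCombRows (Res combRowsT combBondT)
open Summit.QuantumFields.BalabanUV.Beta.FP.TorusCombNestedBasis (resBigEquiv)
open Summit.QuantumFields.BalabanUV.Beta.GAN24.FineReadoutCauchyFrame (toSite_mem_range)
open Summit.QuantumFields.BalabanUV.Beta.FP.NestedStepLawTorusTransportedGradedSymULow (secondVar_oneShot_nestedStepLaw_torus_transported_graded_sym_uLow)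
open Summit.QuantumFields.BalabanUV.Beta.FP.NestedStepLawTorusTransportedRowsGradedSym (perF_bhKStepSh_Dsh_ff_eq_perF_bhKStepAt torus_t1_sym_of_average_dead)
open Summit.QuantumFields.BalabanUV.Beta.FP.PeriodisedWardOrderZero (torus_a0_letter torus_H₀_transpose)
open Summit.QuantumFields.BalabanUV.Beta.FP.PeriodisedSymBorderWardContactInstance (torus_c1_symVhSAt_weighted)
open Summit.QuantumFields.BalabanUV.Beta.FP.PeriodisedSymCoarseWardContact (torus_d1_symVhSAt_weighted)
open Summit.QuantumFields.BalabanUV.Beta.FP.NestedStepLawTorusInstanceRows (torus_combSlice_mul_Db1_eq_zero)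
open Summit.QuantumFields.BalabanUV.Beta.FP.PeriodisedSymCompositeIndexWard (torus_q1_sym_letter)
open Summit.QuantumFields.BalabanUV.Beta.FP.TorusGeneratorIntertwining (torus_j1 weightedJet_eq)

variable {d : ℕ}

/-! ## §1 The (III′) torus call with the rows discharged -/

section Rows

variable (M' : Fin (d + 1) → ℕ) [∀ μ, NeZero (M' μ)] {Lc : ℕ} [NeZero Lc]

set_option synthInstance.maxSize 1024 in
/-- [folklore] **THE (III′) TORUS CALL (uLow BOTTOM) WITH leaf-02's ROWS, leaf-06's `j1` AND `hH₀t` DISCHARGED BY TERM** — as (β-b)'s theorem with `s1 s2 ↦ uLow`.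
`NestedStepLawTorusTransportedGradedSym.secondVar_oneShot_nestedStepLaw_torus_transported_graded_sym` ((β-a)) with: the form block bound to `𝕄_j`'s (`hH₀`);
the sym insertion-table families, the generator jet and the coarse jet bound by defining equations along a direction `h` (`hQ₁₁ hQ₂₁ hW₁ hDb₁`); the transport
generators `X X̄` PINNED to the diagonal gauge generators of a parameter `λ` at the centred roots (`hX hXbar`); the one-shot literal's first composite averaging
jet NAMED along `h + Dλ` (`h𝔔'₁`); the one-shot chart's generator first jet in closed form `hW'₁` and the parameter transport `c • C₁(λ)` (`hC₁`); and the
binders `hH₀t a0 c1 d1 t1 q1 j1` REMOVED — supplied inside by `torus_H₀_transpose` ∕ `torus_a0_letter` (at `r := ctrOff`, after §0), `torus_c1_symVhSAt_weighted`,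
`torus_d1_symVhSAt_weighted`, `c1 ∘ torus_combSlice_mul_Db1_eq_zero` (`hdead` displayed), `torus_q1_sym_letter`, `torus_j1 ∘ weightedJet_eq`.  Displayed, as the
(β-a) call: `h1 h2`, `k1 k2`, `a1 a2` (read at `Y₀ = 0`), `hH₁t hH₂t`, `uP'`, `q2 j2 uC s1 s2 t2 c2 d2`.  Conclusion VERBATIM (β-a)'s. -/
theorem secondVar_oneShot_nestedStepLaw_torus_transported_graded_rows_sym_uLow (hM' : ∀ i, Lc ∣ M' i) (j : ℕ)
    {κ : Type*} [Fintype κ] [DecidableEq κ] (pμ' : κ → ↥(pbox M')) (mμ' : κ → Fin (d + 1))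
    -- the torus objects of record, by defining equations
    {H₀ : Matrix (↥(pbox (fine Lc M')) × Fin (d + 1)) (↥(pbox (fine Lc M')) × Fin (d + 1)) ℝ}
    {Q₁₀ : Matrix (↥(pbox M') × Fin (d + 1)) (↥(pbox (fine Lc M')) × Fin (d + 1)) ℝ}
    {τ₁ : Matrix (Res (ctr (d + 1) Lc) Lc (fine Lc M')) (↥(pbox (fine Lc M')) × Fin (d + 1)) ℝ}
    {τ₂ : Matrix (Res (ctr (d + 1) Lc) Lc M') (↥(pbox M') × Fin (d + 1)) ℝ}
    {D₁ : Matrix (↥(pbox (fine Lc M')) × Fin (d + 1)) (Res (ctr (d + 1) Lc) Lc (fine Lc M')) ℝ}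
    {D₂ : Matrix (↥(pbox (fine Lc M')) × Fin (d + 1)) (Res (ctr (d + 1) Lc) Lc M') ℝ}
    {Dbar : Matrix (↥(pbox M') × Fin (d + 1)) (Res (ctr (d + 1) Lc) Lc M') ℝ}
    {P : Matrix (Res (ctr (d + 1) Lc) Lc M' ⊕ Res (ctr (d + 1) Lc) Lc (fine Lc M')) (↥(pbox (fine Lc M')) × Fin (d + 1)) ℝ}
    (hH₀ : H₀ = (perF (fine Lc M') (bhKStepSh d Lc (Dsh Lc) j)).submatrix
        (fun b : ↥(pbox (fine Lc M')) × Fin (d + 1) => ((b.1, Sum.inl b.2) : Idx (fine Lc M') (Fib d)))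
        (fun b : ↥(pbox (fine Lc M')) × Fin (d + 1) => ((b.1, Sum.inl b.2) : Idx (fine Lc M') (Fib d))))
    (hQ₁₀ : Q₁₀ = (perF (fine Lc M') (bhKStepSh d Lc (Dsh Lc) j)).submatrix
        (fun a : ↥(pbox M') × Fin (d + 1) => ((coarsePt M' Lc a.1, Sum.inr a.2) : Idx (fine Lc M') (Fib d)))
        (fun b : ↥(pbox (fine Lc M')) × Fin (d + 1) => ((b.1, Sum.inl b.2) : Idx (fine Lc M') (Fib d))))
    (hτ₁ : τ₁ = (combRowsT (ctr (d + 1) Lc) Lc (fine Lc M')).submatrix id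
        (fun b : ↥(pbox (fine Lc M')) × Fin (d + 1) => ((b.1, Sum.inl b.2) : Idx (fine Lc M') (Fib d))))
    (hτ₂ : τ₂ = (combRowsT (ctr (d + 1) Lc) Lc M').submatrix id (fun b : ↥(pbox M') × Fin (d + 1) => ((b.1, Sum.inl b.2) : Idx M' (Fib d))))
    (hD₁ : D₁ = (tgrad (fine Lc M')).submatrix (fun b : ↥(pbox (fine Lc M')) × Fin (d + 1) => ((b.1, Sum.inl b.2) : Idx (fine Lc M') (Fib d)))
        (Subtype.val : Res (ctr (d + 1) Lc) Lc (fine Lc M') → ↥(pbox (fine Lc M'))))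
    (hD₂ : D₂ = (tgradBlock M' Lc).submatrix (fun b : ↥(pbox (fine Lc M')) × Fin (d + 1) => ((b.1, Sum.inl b.2) : Idx (fine Lc M') (Fib d)))
        (Subtype.val : Res (ctr (d + 1) Lc) Lc M' → ↥(pbox M')))
    (hDbar : Dbar = Matrix.of fun (a : ↥(pbox M') × Fin (d + 1)) (t : Res (ctr (d + 1) Lc) Lc M') =>
        stepScale d Lc j * (((box (d + 1) Lc).card : ℝ) * tgrad M' (a.1, Sum.inl a.2) t.1))
    (hP : P = (combRowsT ((Lc : ℤ) • ctr (d + 1) Lc + ctr (d + 1) Lc) (Lc * Lc) (fine Lc M')).submatrix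
        (resBigEquiv Lc Lc (ctr (d + 1) Lc) (ctr (d + 1) Lc) M' (Nat.pos_of_ne_zero (NeZero.ne Lc)) (toSite_mem_range (ctrOff_mem_box (Nat.one_le_iff_ne_zero.mpr (NeZero.ne Lc))))
          (Nat.pos_of_ne_zero (NeZero.ne Lc)) (toSite_mem_range (ctrOff_mem_box (Nat.one_le_iff_ne_zero.mpr (NeZero.ne Lc))))).symm
        (fun b : ↥(pbox (fine Lc M')) × Fin (d + 1) => ((b.1, Sum.inl b.2) : Idx (fine Lc M') (Fib d))))
    -- the displayed jets: form, averaging (both levels), block covariance, generators (fine and coarse), Ward witnesses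
    (H₁ H₂ : Matrix (↥(pbox (fine Lc M')) × Fin (d + 1)) (↥(pbox (fine Lc M')) × Fin (d + 1)) ℝ)
    {Q₂₀ : Matrix κ (↥(pbox M') × Fin (d + 1)) ℝ}
    (hQ₂₀ : Q₂₀ = (perF M' (bhKStepSh d Lc (Dsh Lc) (j + 1))).submatrix (fun a : κ => ((pμ' a, Sum.inr (mμ' a)) : Idx M' (Fib d)))
        (fun b : ↥(pbox M') × Fin (d + 1) => ((b.1, Sum.inl b.2) : Idx M' (Fib d))))
    -- leaf-02's ORDER-1 ROWS ALONG A DIRECTION `h` AND THE GAUGE PARAMETER `λ` OF THE CHART TRANSPORT: the insertion-table families (fine, and coarse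
    -- transported by `θ_j·Q₁₀`), the generator jet and the coarse jet by their defining equations (p314580, `PeriodisedCoarseWardContact`, `NestedStepLawTorusInstanceRows`)
    (h : ↥(pbox (fine Lc M')) × Fin (d + 1) → ℝ) (lam : ↥(pbox (fine Lc M')) → ℝ)
    (Q₁₁ : (↥(pbox (fine Lc M')) × Fin (d + 1) → ℝ) → Matrix (↥(pbox M') × Fin (d + 1)) (↥(pbox (fine Lc M')) × Fin (d + 1)) ℝ)
    (hQ₁₁ : ∀ w, Q₁₁ w = ∑ b : ↥(pbox (fine Lc M')) × Fin (d + 1), w b •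
        (perF (fine Lc M') (dper (fine Lc M') (symVhSAt (ctr (d + 1) Lc) d Lc rfl b.2 (b.1 : Site (d + 1))))).submatrix
          (fun a : ↥(pbox M') × Fin (d + 1) => ((coarsePt M' Lc a.1, Sum.inr a.2) : Idx (fine Lc M') (Fib d)))
          (fun b : ↥(pbox (fine Lc M')) × Fin (d + 1) => ((b.1, Sum.inl b.2) : Idx (fine Lc M') (Fib d))))
    (Q₂₁ : (↥(pbox (fine Lc M')) × Fin (d + 1) → ℝ) → Matrix κ (↥(pbox M') × Fin (d + 1)) ℝ)
    (hQ₂₁ : ∀ w, Q₂₁ w = ∑ b : ↥(pbox (fine Lc M')) × Fin (d + 1), w b •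
        ∑ a' : ↥(pbox M') × Fin (d + 1), (stepScale d Lc (j + 1) / (stepScale d Lc j ^ 2 * ((box (d + 1) Lc).card : ℝ)) * Q₁₀ a' b) •
          (perF M' (dper M' (symVhSAt (ctr (d + 1) Lc) d Lc rfl a'.2 (a'.1 : Site (d + 1))))).submatrix (fun a : κ => ((pμ' a, Sum.inr (mμ' a)) : Idx M' (Fib d)))
            (fun b : ↥(pbox M') × Fin (d + 1) => ((b.1, Sum.inl b.2) : Idx M' (Fib d))))
    {W₁ : Matrix (↥(pbox (fine Lc M')) × Fin (d + 1)) (Res (ctr (d + 1) Lc) Lc M' ⊕ Res (ctr (d + 1) Lc) Lc (fine Lc M')) ℝ}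
    (hW₁ : W₁ = ∑ b : ↥(pbox (fine Lc M')) × Fin (d + 1), h b •
        Matrix.of (fun (b' : ↥(pbox (fine Lc M')) × Fin (d + 1)) (e : Res (ctr (d + 1) Lc) Lc M' ⊕ Res (ctr (d + 1) Lc) Lc (fine Lc M')) =>
          if b' = b then
            -((((Lc : ℝ) ^ (d + 1) * stepScale d Lc j)⁻¹)
              * Sum.elim (fun t : Res (ctr (d + 1) Lc) Lc M' => tdelta M' (quo Lc ((b.1 : Site (d + 1)) + unitVec b.2)) t.1)
                  (fun s : Res (ctr (d + 1) Lc) Lc (fine Lc M') => tdelta (fine Lc M') ((b.1 : Site (d + 1)) + unitVec b.2) s.1) e)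
          else 0))
    {Db₁ : Matrix (↥(pbox M') × Fin (d + 1)) (Res (ctr (d + 1) Lc) Lc M') ℝ}
    (hDb₁ : Db₁ = ∑ b : ↥(pbox (fine Lc M')) × Fin (d + 1), h b •
        Matrix.of fun (a : ↥(pbox M') × Fin (d + 1)) (t : Res (ctr (d + 1) Lc) Lc M') =>
          -((((Lc : ℝ) ^ (d + 1) * stepScale d Lc j)⁻¹) * Q₁₀ a b * tdelta M' ((a.1 : Site (d + 1)) + unitVec a.2) t.1))
    -- the NESTED chart's direction is average-coarse-comb-dead (the hypothesis of `torus_t1_of_average_dead`)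
    (hdead : ∀ (a : ↥(pbox M') × Fin (d + 1)) (x : Res (ctr (d + 1) Lc) Lc M'),
      combBondT (ctr (d + 1) Lc) Lc M' x = ((a.1, Sum.inl a.2) : Idx M' (Fib d)) → ∑ b : ↥(pbox (fine Lc M')) × Fin (d + 1), Q₁₀ a b * h b = 0)
    -- the second-order data stay displayed
    (Q₁₂ : Matrix (↥(pbox M') × Fin (d + 1)) (↥(pbox (fine Lc M')) × Fin (d + 1)) ℝ) (Q₂₂ : Matrix κ (↥(pbox M') × Fin (d + 1)) ℝ)
    (W₂ : Matrix (↥(pbox (fine Lc M')) × Fin (d + 1)) (Res (ctr (d + 1) Lc) Lc M' ⊕ Res (ctr (d + 1) Lc) Lc (fine Lc M')) ℝ)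
    (Db₂ : Matrix (↥(pbox M') × Fin (d + 1)) (Res (ctr (d + 1) Lc) Lc M') ℝ)
    (Y₁ Y₂ : Matrix κ (Res (ctr (d + 1) Lc) Lc M' ⊕ Res (ctr (d + 1) Lc) Lc (fine Lc M')) ℝ)
    -- the chart transport (exponential currency): generators `X` (fields), `X̄` (composite multipliers); the one-shot chart's generator jets `W♯₁ W♯₂`;
    -- the parameter-transport jets `C₁ C₂`
    {X : Matrix (↥(pbox (fine Lc M')) × Fin (d + 1)) (↥(pbox (fine Lc M')) × Fin (d + 1)) ℝ} {Xbar : Matrix κ κ ℝ}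
    -- (T-β-1) at the torus: the transport generators ARE the diagonal gauge generators of the parameter `λ` (fields: `−c•E_λ`; composite multipliers: `c•R′_λ̄`)
    (hX : X = -((((Lc : ℝ) ^ (d + 1) * stepScale d Lc j)⁻¹) • Matrix.diagonal (fun b : ↥(pbox (fine Lc M')) × Fin (d + 1) => lam b.1)))
    (hXbar : Xbar = (((Lc : ℝ) ^ (d + 1) * stepScale d Lc j)⁻¹) •
        Matrix.diagonal (fun α : κ => ∑ t : ↥(pbox M'), tdelta M' ((pμ' α : Site (d + 1)) + ctr (d + 1) Lc) t
          * (∑ s : ↥(pbox (fine Lc M')), tdelta (fine Lc M') ((Lc : ℤ) • (t : Site (d + 1)) + ctr (d + 1) Lc) s * lam s)))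
    -- (T-β-4) AT THE TORUS (leaf-06 `TorusGeneratorIntertwining`): the one-shot chart's generator first jet IS the nested chart's generator jet ALONG THE
    -- GAUGE-SHIFTED DIRECTION `h + Dλ`, by its defining equation in closed form (`weightedJet_eq` currency)
    {W'₁ : Matrix (↥(pbox (fine Lc M')) × Fin (d + 1)) (Res (ctr (d + 1) Lc) Lc M' ⊕ Res (ctr (d + 1) Lc) Lc (fine Lc M')) ℝ}
    (hW'₁ : W'₁ = Matrix.of fun (b : ↥(pbox (fine Lc M')) × Fin (d + 1)) (e : Res (ctr (d + 1) Lc) Lc M' ⊕ Res (ctr (d + 1) Lc) Lc (fine Lc M')) =>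
        -((((Lc : ℝ) ^ (d + 1) * stepScale d Lc j)⁻¹) * (h b + ∑ s, tgrad (fine Lc M') (b.1, Sum.inl b.2) s * lam s)
          * Sum.elim (fun t : Res (ctr (d + 1) Lc) Lc M' => tdelta M' (quo Lc ((b.1 : Site (d + 1)) + unitVec b.2)) t.1)
            (fun s : Res (ctr (d + 1) Lc) Lc (fine Lc M') => tdelta (fine Lc M') ((b.1 : Site (d + 1)) + unitVec b.2) s.1) e))
    (W'₂ : Matrix (↥(pbox (fine Lc M')) × Fin (d + 1)) (Res (ctr (d + 1) Lc) Lc M' ⊕ Res (ctr (d + 1) Lc) Lc (fine Lc M')) ℝ)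
    -- the parameter-transport GENERATOR `C₁(λ)` by leaf-06's defining equation `hC₁` VERBATIM («multiplication by `λ` in the gauge-mode basis»: `diagonal λ̄`
    -- on the coarse residual parameters, `diagonal (λ∘val)` on the fine ones, coarse-to-fine block `(λ s − λ̄ t)·[block s = t]`); the transport is `c • C₁`
    {C₁ : Matrix (Res (ctr (d + 1) Lc) Lc M' ⊕ Res (ctr (d + 1) Lc) Lc (fine Lc M')) (Res (ctr (d + 1) Lc) Lc M' ⊕ Res (ctr (d + 1) Lc) Lc (fine Lc M')) ℝ}
    (hC₁ : C₁ = Matrix.fromBlocks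
        (Matrix.diagonal fun t : Res (ctr (d + 1) Lc) Lc M' =>
          ∑ s, tdelta (fine Lc M') ((Lc : ℤ) • ((t.1 : ↥(pbox M')) : Site (d + 1)) + ctr (d + 1) Lc) s * lam s)
        (0 : Matrix (Res (ctr (d + 1) Lc) Lc M') (Res (ctr (d + 1) Lc) Lc (fine Lc M')) ℝ)
        (Matrix.of fun (s : Res (ctr (d + 1) Lc) Lc (fine Lc M')) (t : Res (ctr (d + 1) Lc) Lc M') =>
          (lam s.1 - ∑ s', tdelta (fine Lc M') ((Lc : ℤ) • ((t.1 : ↥(pbox M')) : Site (d + 1)) + ctr (d + 1) Lc) s' * lam s')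
            * tdelta M' (quo Lc ((s.1 : ↥(pbox (fine Lc M'))) : Site (d + 1))) t.1)
        (Matrix.diagonal fun s : Res (ctr (d + 1) Lc) Lc (fine Lc M') => lam s.1))
    (C₂ : Matrix (Res (ctr (d + 1) Lc) Lc M' ⊕ Res (ctr (d + 1) Lc) Lc (fine Lc M')) (Res (ctr (d + 1) Lc) Lc M' ⊕ Res (ctr (d + 1) Lc) Lc (fine Lc M')) ℝ)
    {𝔔₀ 𝔔₁ 𝔔₂ : Matrix κ (↥(pbox (fine Lc M')) × Fin (d + 1)) ℝ}
    (h𝔔₀ : Q₂₀ * Q₁₀ = 𝔔₀) (h𝔔₁ : Q₂₁ h * Q₁₀ + Q₂₀ * Q₁₁ h = 𝔔₁)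
    (h𝔔₂ : Q₂₂ * Q₁₀ + Q₂₁ h * Q₁₁ h + (Q₂₁ h * Q₁₁ h + Q₂₀ * Q₁₂) = 𝔔₂)
    -- (T-β-1) GRADED: the ONE-SHOT literal's composite jets are the graded `X`-conjugated words of the nested-chart jets (`𝔎 = H`: δ-constrained), NAMED
    {H'₁ H'₂ : Matrix (↥(pbox (fine Lc M')) × Fin (d + 1)) (↥(pbox (fine Lc M')) × Fin (d + 1)) ℝ}
    {𝔔'₁ 𝔔'₂ : Matrix κ (↥(pbox (fine Lc M')) × Fin (d + 1)) ℝ}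
    -- `q1` DISCHARGED (`PeriodisedCompositeIndexWard.torus_q1_letter`): the one-shot literal's first composite averaging jet IS the composite insertion jet
    -- along the GAUGE-SHIFTED direction `h + Dλ`, NAMED
    (h𝔔'₁ : Q₂₁ (fun b => h b + ∑ s : ↥(pbox (fine Lc M')), tgrad (fine Lc M') (b.1, Sum.inl b.2) s * lam s) * Q₁₀
        + Q₂₀ * Q₁₁ (fun b => h b + ∑ s : ↥(pbox (fine Lc M')), tgrad (fine Lc M') (b.1, Sum.inl b.2) s * lam s) = 𝔔'₁)
    (k1 : -(Xᵀ * H₀) + H₁ + H₀ * X = H'₁)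
    (k2 : (X * X)ᵀ * H₀ + (-(Xᵀ * H₁) + -(Xᵀ * H₀ * X)) + ((-(Xᵀ * H₁) + -(Xᵀ * H₀ * X)) + (H₂ + H₁ * X + (H₁ * X + H₀ * (X * X)))) = H'₂)
    (q2 : Xbar * Xbar * 𝔔₀ + (Xbar * 𝔔₁ + Xbar * 𝔔₀ * X) + ((Xbar * 𝔔₁ + Xbar * 𝔔₀ * X) + (𝔔₂ + 𝔔₁ * X + (𝔔₁ * X + 𝔔₀ * (X * X)))) = 𝔔'₂)
    -- (T-β-4): `j1` DISCHARGED (`torus_j1`); order 2 of the intertwining and the unimodularity of the parameter transport stay letters, at `c • C₁(λ)`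
    (j2 : X * X * fromCols D₂ D₁ + (2 : ℝ) • (-X * W₁) + W₂ = W'₂ + (2 : ℝ) • (W'₁ * ((((Lc : ℝ) ^ (d + 1) * stepScale d Lc j)⁻¹) • C₁)) + fromCols D₂ D₁ * C₂)
    (uC : secondVar (1 : Matrix (Res (ctr (d + 1) Lc) Lc M' ⊕ Res (ctr (d + 1) Lc) Lc (fine Lc M')) (Res (ctr (d + 1) Lc) Lc M' ⊕ Res (ctr (d + 1) Lc) Lc (fine Lc M')) ℝ)
      ((((Lc : ℝ) ^ (d + 1) * stepScale d Lc j)⁻¹) • C₁) C₂ = 0)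
    -- the one-shot chart's (UNI)-jet letter (dead big-comb rows `NestedStepLawTransportedDeadRows`, or `TorusOneShotFPExponential.torus_uP_exp`), at the
    -- closed-form `W′₁`; dead rows of the nested chart: the small comb rows, and the order-2 coarse comb row of the average (`t1` DISCHARGED)
    (uP' : secondVar (P * fromCols D₂ D₁) (P * W'₁) (P * W'₂) = 0)
    -- the fine block's Faddeev–Popov 2-jet on the small comb (leaf-06 `NestedFPSplit`; replaces `s1 s2`; discharged at the (β-b′) layer by `torus_uLow_exp`)
    (uLow : secondVar (τ₁ * (fromCols D₂ D₁).toCols₂) (τ₁ * W₁.toCols₂) (τ₁ * W₂.toCols₂) = 0)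
    (t2 : τ₂ * (Q₁₂ * fromCols D₂ D₁ + (2 : ℝ) • (Q₁₁ h * W₁) + Q₁₀ * W₂) = 0)
    -- the parities of the displayed form jets (`H₀ᵀ = H₀` is a theorem, discharged inside the graded call: `PeriodisedWardOrderZero.torus_H₀_transpose`)
    (hH₁t : H₁ᵀ = -H₁) (hH₂t : H₂ᵀ = H₂)
    -- the GRADED second-order composite Ward TABLE IDENTITIES (δ-constrained: `𝔎 = H`; the door's one-sided graded shapes, `W₀ := [D₂ | D₁]`), read at
    -- `Y₀ = 0`; orders 1 and 2 only (order 0 `a0` DISCHARGED: `PeriodisedWardOrderZero.torus_a0_letter`); NO transposed rows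
    (a1 : H₁ * fromCols D₂ D₁ + H₀ * W₁ = 𝔔₀ᵀ * Y₁)
    (a2 : H₂ * fromCols D₂ D₁ + (2 : ℝ) • (H₁ * W₁) + H₀ * W₂ = -((2 : ℝ) • (𝔔₁ᵀ * Y₁)) + 𝔔₀ᵀ * Y₂)
    -- the insertion-table covariance TABLE IDENTITIES and the coarse covariance identities (order 0 discharged in p316503)
    -- order 2 only (order 1 `c1 d1` DISCHARGED: p314580, `PeriodisedCoarseWardContact`)
    (c2 : Q₁₂ * fromCols D₂ D₁ + (2 : ℝ) • (Q₁₁ h * W₁) + Q₁₀ * W₂ = fromCols Db₂ 0)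
    (d2 : Q₂₂ * Dbar + (2 : ℝ) • (Q₂₁ h * Db₁) + Q₂₀ * Db₂ = 0)
    -- block namings and the coarse non-degeneracy
    {Γ : Matrix (↥(pbox (fine Lc M')) × Fin (d + 1)) (↥(pbox (fine Lc M')) × Fin (d + 1)) ℝ}
    {I : Matrix (↥(pbox (fine Lc M')) × Fin (d + 1)) ((↥(pbox M') × Fin (d + 1)) ⊕ Res (ctr (d + 1) Lc) Lc (fine Lc M')) ℝ}
    {L : Matrix ((↥(pbox M') × Fin (d + 1)) ⊕ Res (ctr (d + 1) Lc) Lc (fine Lc M')) (↥(pbox (fine Lc M')) × Fin (d + 1)) ℝ}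
    {S : Matrix ((↥(pbox M') × Fin (d + 1)) ⊕ Res (ctr (d + 1) Lc) Lc (fine Lc M')) ((↥(pbox M') × Fin (d + 1)) ⊕ Res (ctr (d + 1) Lc) Lc (fine Lc M')) ℝ}
    {B : Matrix ((↥(pbox M') × Fin (d + 1)) ⊕ Res (ctr (d + 1) Lc) Lc (fine Lc M')) (↥(pbox (fine Lc M')) × Fin (d + 1)) ℝ}
    (hΓ : flucCov H₀ (fromRows Q₁₀ τ₁) = Γ) (hI : minOp H₀ (fromRows Q₁₀ τ₁) = I) (hL : minOpL H₀ (fromRows Q₁₀ τ₁) = L) (hS : effForm H₀ (fromRows Q₁₀ τ₁) = S)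
    (hB : fromRows (Q₁₁ h) (0 : Matrix (Res (ctr (d + 1) Lc) Lc (fine Lc M')) (↥(pbox (fine Lc M')) × Fin (d + 1)) ℝ) = B)
    -- (γ-sym) SOCKETS DISPLAYED (leaf-05 g29: `torus_isUnit_det_kkt_combRows_comb` ∕ `torus_h2_record_comb` at the sym tables)
    (h1 : (kkt H₀ (fromRows Q₁₀ τ₁)).det ≠ 0) (h2 : (kkt S.toBlocks₁₁ (fromRows Q₂₀ τ₂)).det ≠ 0) :
    secondVar (kkt H₀ (fromRows 𝔔₀ P))
        (fromBlocks H'₁ (-(fromRows 𝔔'₁ (0 : Matrix (Res (ctr (d + 1) Lc) Lc M' ⊕ Res (ctr (d + 1) Lc) Lc (fine Lc M')) (↥(pbox (fine Lc M')) × Fin (d + 1)) ℝ))ᵀ)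
          (fromRows 𝔔'₁ (0 : Matrix (Res (ctr (d + 1) Lc) Lc M' ⊕ Res (ctr (d + 1) Lc) Lc (fine Lc M')) (↥(pbox (fine Lc M')) × Fin (d + 1)) ℝ)) 0)
        (kkt H'₂ (fromRows 𝔔'₂ (0 : Matrix (Res (ctr (d + 1) Lc) Lc M' ⊕ Res (ctr (d + 1) Lc) Lc (fine Lc M')) (↥(pbox (fine Lc M')) × Fin (d + 1)) ℝ)))
      = secondVar (kkt H₀ (fromRows Q₁₀ τ₁)) (fromBlocks H₁ (-Bᵀ) B 0)
            (kkt H₂ (fromRows Q₁₂ (0 : Matrix (Res (ctr (d + 1) Lc) Lc (fine Lc M')) (↥(pbox (fine Lc M')) × Fin (d + 1)) ℝ)))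
        + secondVar
            (kkt S.toBlocks₁₁ (fromRows Q₂₀ τ₂))
            (fromBlocks ((L * H₁ - S * B) * I + L * Bᵀ * S).toBlocks₁₁ (-(fromRows (Q₂₁ h) (0 : Matrix (Res (ctr (d + 1) Lc) Lc M') (↥(pbox M') × Fin (d + 1)) ℝ))ᵀ)
              (fromRows (Q₂₁ h) (0 : Matrix (Res (ctr (d + 1) Lc) Lc M') (↥(pbox M') × Fin (d + 1)) ℝ)) 0)
            (kkt (((-((L * H₁ - S * B) * Γ - L * Bᵀ * L) * H₁ + L * H₂
                      - (((L * H₁ - S * B) * I + L * Bᵀ * S) * B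
                          + S * fromRows Q₁₂ (0 : Matrix (Res (ctr (d + 1) Lc) Lc (fine Lc M')) (↥(pbox (fine Lc M')) × Fin (d + 1)) ℝ))) * I
                    + (L * H₁ - S * B) * (-((Γ * H₁ + I * B) * I + Γ * Bᵀ * S)))
                  - ((-((L * H₁ - S * B) * Γ - L * Bᵀ * L) * (-Bᵀ)
                        + L * (fromRows Q₁₂ (0 : Matrix (Res (ctr (d + 1) Lc) Lc (fine Lc M')) (↥(pbox (fine Lc M')) × Fin (d + 1)) ℝ))ᵀ) * S
                      + L * (-Bᵀ) * ((L * H₁ - S * B) * I + L * Bᵀ * S))).toBlocks₁₁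
              (fromRows Q₂₂ (0 : Matrix (Res (ctr (d + 1) Lc) Lc M') (↥(pbox M') × Fin (d + 1)) ℝ))) := by
  have hρ : ctrOff (d + 1) Lc ∈ box (d + 1) Lc := ctrOff_mem_box (Nat.one_le_iff_ne_zero.mpr (NeZero.ne Lc))
  -- §0: the form block of `𝕄_j` IS the rooted candidate's at the centred root `ρ_c = toSite (ctrOff (d+1) Lc)`
  have hH₀' := hH₀.trans (perF_bhKStepSh_Dsh_ff_eq_perF_bhKStepAt (fine Lc M') j)
  subst hX hXbar hW₁ hDb₁
  -- (T-β-1) `q1`: the conjugated first composite averaging word IS the composite sym insertion jet along `h + Dλ` (leaf-02 `PeriodisedSymCompositeIndexWard`)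
  have q1 := torus_q1_sym_letter M' hM' j h lam pμ' mμ' hQ₁₀ hQ₂₀ Q₁₁ hQ₁₁ Q₂₁ hQ₂₁ h𝔔₀ h𝔔₁
  rw [h𝔔'₁] at q1
  exact secondVar_oneShot_nestedStepLaw_torus_transported_graded_sym_uLow M' hM' j pμ' mμ' hQ₁₀ hτ₁ hτ₂ hD₁ hD₂ hDbar hP H₁ H₂ hQ₂₀
    (Q₁₁ h) Q₁₂ (Q₂₁ h) Q₂₂ _ W₂ _ Db₂ 0 Y₁ Y₂ _ _ W'₁ W'₂ ((((Lc : ℝ) ^ (d + 1) * stepScale d Lc j)⁻¹) • C₁) C₂ h𝔔₀ h𝔔₁ h𝔔₂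
    k1 k2 q1 q2
    -- `j1` BY TERM: the summed generator jet in closed form (leaf-06 `weightedJet_eq`), then leaf-06's `torus_j1` at the centred roots
    (torus_j1 M' lam (((Lc : ℝ) ^ (d + 1) * stepScale d Lc j)⁻¹) h hD₁ hD₂ hC₁ rfl
      (weightedJet_eq M' (((Lc : ℝ) ^ (d + 1) * stepScale d Lc j)⁻¹) h
        (fun (b : ↥(pbox (fine Lc M')) × Fin (d + 1)) (e : Res (ctr (d + 1) Lc) Lc M' ⊕ Res (ctr (d + 1) Lc) Lc (fine Lc M')) =>
          Sum.elim (fun t : Res (ctr (d + 1) Lc) Lc M' => tdelta M' (quo Lc ((b.1 : Site (d + 1)) + unitVec b.2)) t.1)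
            (fun s : Res (ctr (d + 1) Lc) Lc (fine Lc M') => tdelta (fine Lc M') ((b.1 : Site (d + 1)) + unitVec b.2) s.1) e))
      hW'₁)
    j2 uC uP' uLow
    -- `t1` BY TERM (this file's `torus_t1_sym_of_average_dead`: sym `c1`, then the coarse comb slice kills the coarse jet where the direction's average dies)
    (torus_t1_sym_of_average_dead M' j h hQ₁₀ hD₁ hD₂ hτ₂ (hQ₁₁ h) rfl hdead)
    t2
    -- `hH₀t` BY TERM (leaf-02 `PeriodisedWardOrderZero.torus_H₀_transpose` at the centred root, after §0)
    (torus_H₀_transpose M' j hH₀') hH₁t hH₂t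
    -- `a0` BY TERM at `Y₀ := 0`; the graded `a1 a2` read at `Y₀ = 0`
    (torus_a0_letter M' hρ j hH₀' hD₁ hD₂ 𝔔₀) (by rw [Matrix.mul_zero, neg_zero, zero_add]; exact a1) (by rw [Matrix.mul_zero, zero_add]; exact a2)
    -- `c1`, `d1` BY TERM (leaf-02 (α-1b) sym producers)
    (by rw [hQ₁₁ h]; exact torus_c1_symVhSAt_weighted M' j h hQ₁₀ hD₁ hD₂) c2
    (by rw [hQ₂₁ h]; exact torus_d1_symVhSAt_weighted M' hM' j pμ' mμ' hQ₂₀ hDbar Q₁₀ h) d2 hΓ hI hL hS hB h1 h2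

end Rows

end Summit.QuantumFields.BalabanUV.Beta.FP.NestedStepLawTorusTransportedRowsGradedSymULow

end
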